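import Summits.BirchSwinnertonDyer.Rank1Residual.X11b.ChaPairsMinimality
import Literature.NumberTheory.EllipticCurves.Fisher2012.HesseFamilyThreeCongruenceProofs
import Literature.NumberTheory.EllipticCurves.Fisher2012.HesseFamilyThreeReverseProofs
import HarnessLib

/-!
# Route (3e) SELMER COMPANION, XL-C: the 3-CONGRUENCES of the shape-F rows as KERNEL THEOREMS — per-pair
# records, part C (class X11a = N7; cell `b2b-bsdres`, unit `b2b-bsdres-x11a`, gen 32)

HONEST FRAMING (run/shared/lean/b2b/bsd-rank1-residual/, verbatim in every file): the goal of the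
cell is to DELETE the COMBINATION-SHAPED residual classes of the Birch–Swinnerton-Dyer formula for
ALL analytic-rank `≤ 1` elliptic curves over `ℚ` — "full BSD formula for every rank `≤ 1` curve in
class `C`" assembled STRICTLY from published theorems — so that the rank-`≤ 1` remainder becomes
exactly the CONSTRUCTION-SHAPED classes, which are TYPED (missing-input `Prop`s), NOT attempted.
This is not "finishing BSD". CLASS-OWNERS.md: research routes; NO CLAIM BEYOND STATED CLASSES.
THEOREMS ONLY; nothing booked; no label moves. PER PAIR. No binder: every theorem below is
UNCONDITIONAL (Fisher 2012 Thm. 13.2 / §13 for `n = 3` is PROVED in the tree: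
`Fisher2012.threeCongruent_of_hesseCertificate_unconditional`,
`…_of_dualHesseCertificate_unconditional`).

## What this file proves

The shape-F booking theorems (files XXXVI–XXXIX) take two equivariant isomorphisms as data:
`θ : E[3] ≃ F[3]` (cell ↔ auxiliary curve) and `θ₀ : F[3] ≃ A₀[3]` (auxiliary ↔ closed partner). For
every auxiliary curve `F` certified by the gen-32 search (engine 1 `shapeF.gp`, table
`g32/data/shapeF_certs_v11.tsv`) this file PROVES `F[3] ≃ B[3]` for its pencil base `B ∈ {E, A₀}`
from the Hesse certificate `(λ, μ, u)` — two rational identities, decided by `norm_num` on the tree's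
closed forms `eval_hesseC4three` / `eval_hesseC6three` / `eval_hesseD3` — and, for the (cell, closed
partner) pairs, PROVES `A₀[3] ≃ E[3]` from cc-eng-2's exact X3E certificates
(`class-closure/N7/X3E-closed-partner-eng2.tsv` v1.3: Fisher point, `u²`), the same way. So on every
shape-F row BOTH congruences are kernel theorems (unlike the Kraus–Oesterlé certificates C1 of the
earlier partner routes); the composites `θ`, `θ₀` are `AddEquiv.trans`/`symm` of these. `Δ ≠ 0` is
kernel-decided (`isElliptic_of_discOf_ne_zero`, `decide +kernel`). Nothing else about the rows is
claimed here (reduction types, kinds, points and certificates stay two-engine evidence).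

References: [Fisher2012Hessian] Thm. 13.2, §§8, 9, 13; HOME/b2b-bsdres-x11a/REPORT-g32.md §2.
-/

set_option autoImplicit false

noncomputable section

open WeierstrassCurve Literature.NumberTheory.EllipticCurves
  Literature.NumberTheory.EllipticCurves.Fisher2012 Summit.BirchSwinnertonDyer.Rank1Residual.X11b

namespace Summit.BirchSwinnertonDyer.Rank1Residual.X11a.SelmerCompanion.Congruences

/-- **`G[3] ≃ B[3]`** for `G = [0, 1, 1, -16884, -647702]`, `B = [1, 0, 1, -10904114, 20120476439]`: closed partner A0 = 1369f1 of cell 45177m1, member (59977:1) of the dual Hesse pencil of 45177m1 (cc-eng-2 X3E v1.3 exact certificate, u^2 = 1/7496644); Hesse certificate `(λ, μ, u) = (59977, 1, 1/2738)`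
(kernel-checked identities `𝔠(λ,μ) = u⁴c₄(G)`, `u⁶c₆(G)`). Per pair; books nothing. [cite: Fisher2012Hessian, §13 (analogue of Thm. 13.2 for X_E^-(3))] -/
theorem threeCongruent_45177m1_1369f1_x3e (B G : WeierstrassCurve ℚ)
    (hB : B = ⟨1, 0, 1, (-10904114), 20120476439⟩) (hG : G = ⟨0, 1, 1, (-16884), (-647702)⟩) :
    ∃ e : geomTorsion G (3 : ℤ) ≃+ geomTorsion B (3 : ℤ),
      ∀ (σ : Field.absoluteGaloisGroup ℚ) (Q : geomTorsion G (3 : ℤ)), e (σ • Q) = σ • e Q := by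
  subst hB hG
  have hB' := isElliptic_of_discOf_ne_zero 1 0 1 (-10904114) 20120476439 (by decide +kernel)
  have hG' := isElliptic_of_discOf_ne_zero 0 1 1 (-16884) (-647702) (by decide +kernel)
  refine @threeCongruent_of_dualHesseCertificate_unconditional _ _ hB' hG' (59977) 1 (1 / 2738 : ℚ) (by norm_num) ?_ ?_
  · rw [eval_hesseD3]
    norm_num [WeierstrassCurve.c₆, WeierstrassCurve.c₄, WeierstrassCurve.b₂, WeierstrassCurve.b₄,
      WeierstrassCurve.b₆]
  · rw [eval_hesseC6three]
    norm_num [WeierstrassCurve.c₆, WeierstrassCurve.c₄, WeierstrassCurve.b₂, WeierstrassCurve.b₄,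
      WeierstrassCurve.b₆]

/-- **`G[3] ≃ B[3]`** for `G = [0, 1, 0, -114, -2528]`, `B = [0, 1, 0, -11776, 5629532]`: closed partner A0 = 1568f1 of cell 136416bc1, member (-5012:1) of the dual Hesse pencil of 136416bc1 (cc-eng-2 X3E v1.3 exact certificate, u^2 = 1/38416); Hesse certificate `(λ, μ, u) = (-5012, 1, 1/196)`
(kernel-checked identities `𝔠(λ,μ) = u⁴c₄(G)`, `u⁶c₆(G)`). Per pair; books nothing. [cite: Fisher2012Hessian, §13 (analogue of Thm. 13.2 for X_E^-(3))] -/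
theorem threeCongruent_136416bc1_1568f1_x3e (B G : WeierstrassCurve ℚ)
    (hB : B = ⟨0, 1, 0, (-11776), 5629532⟩) (hG : G = ⟨0, 1, 0, (-114), (-2528)⟩) :
    ∃ e : geomTorsion G (3 : ℤ) ≃+ geomTorsion B (3 : ℤ),
      ∀ (σ : Field.absoluteGaloisGroup ℚ) (Q : geomTorsion G (3 : ℤ)), e (σ • Q) = σ • e Q := by
  subst hB hG
  have hB' := isElliptic_of_discOf_ne_zero 0 1 0 (-11776) 5629532 (by decide +kernel)
  have hG' := isElliptic_of_discOf_ne_zero 0 1 0 (-114) (-2528) (by decide +kernel)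
  refine @threeCongruent_of_dualHesseCertificate_unconditional _ _ hB' hG' (-5012) 1 (1 / 196 : ℚ) (by norm_num) ?_ ?_
  · rw [eval_hesseD3]
    norm_num [WeierstrassCurve.c₆, WeierstrassCurve.c₄, WeierstrassCurve.b₂, WeierstrassCurve.b₄,
      WeierstrassCurve.b₆]
  · rw [eval_hesseC6three]
    norm_num [WeierstrassCurve.c₆, WeierstrassCurve.c₄, WeierstrassCurve.b₂, WeierstrassCurve.b₄,
      WeierstrassCurve.b₆]

/-- **`G[3] ≃ B[3]`** for `G = [1, 1, 0, 504, -13112]`, `B = [1, 1, 1, -13228695633, 583928745083055]`: closed partner A0 = 338d1 of cell 140946s1, member (14503931:19) of the direct Hesse pencil of 140946s1 (cc-eng-2 X3E v1.3 exact certificate, u^2 = 50543902903762944/1); Hesse certificate `(λ, μ, u) = (14503931, 19, 224819712)`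
(kernel-checked identities `𝔠(λ,μ) = u⁴c₄(G)`, `u⁶c₆(G)`). Per pair; books nothing. [cite: Fisher2012Hessian, Thm. 13.2 (n = 3)] -/
theorem threeCongruent_140946s1_338d1_x3e (B G : WeierstrassCurve ℚ)
    (hB : B = ⟨1, 1, 1, (-13228695633), 583928745083055⟩) (hG : G = ⟨1, 1, 0, 504, (-13112)⟩) :
    ∃ e : geomTorsion G (3 : ℤ) ≃+ geomTorsion B (3 : ℤ),
      ∀ (σ : Field.absoluteGaloisGroup ℚ) (Q : geomTorsion G (3 : ℤ)), e (σ • Q) = σ • e Q := by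
  subst hB hG
  have hB' := isElliptic_of_discOf_ne_zero 1 1 1 (-13228695633) 583928745083055 (by decide +kernel)
  have hG' := isElliptic_of_discOf_ne_zero 1 1 0 504 (-13112) (by decide +kernel)
  refine @threeCongruent_of_hesseCertificate_unconditional _ _ hB' hG' (14503931) 19 224819712 (by norm_num) ?_ ?_
  · rw [eval_hesseC4three]
    norm_num [WeierstrassCurve.c₆, WeierstrassCurve.c₄, WeierstrassCurve.b₂, WeierstrassCurve.b₄,
      WeierstrassCurve.b₆]
  · rw [eval_hesseC6three]
    norm_num [WeierstrassCurve.c₆, WeierstrassCurve.c₄, WeierstrassCurve.b₂, WeierstrassCurve.b₄,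
      WeierstrassCurve.b₆]

/-- **`G[3] ≃ B[3]`** for `G = [0, 1, 0, -117, -541]`, `B = [0, 1, 0, 921496, -42723276]`: closed partner A0 = 1936f1 of cell 168432bb1, member (-58564:5) of the dual Hesse pencil of 168432bb1 (cc-eng-2 X3E v1.3 exact certificate, u^2 = 1/7744); Hesse certificate `(λ, μ, u) = (-58564, 5, 1/88)`
(kernel-checked identities `𝔠(λ,μ) = u⁴c₄(G)`, `u⁶c₆(G)`). Per pair; books nothing. [cite: Fisher2012Hessian, §13 (analogue of Thm. 13.2 for X_E^-(3))] -/
theorem threeCongruent_168432bb1_1936f1_x3e (B G : WeierstrassCurve ℚ)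
    (hB : B = ⟨0, 1, 0, 921496, (-42723276)⟩) (hG : G = ⟨0, 1, 0, (-117), (-541)⟩) :
    ∃ e : geomTorsion G (3 : ℤ) ≃+ geomTorsion B (3 : ℤ),
      ∀ (σ : Field.absoluteGaloisGroup ℚ) (Q : geomTorsion G (3 : ℤ)), e (σ • Q) = σ • e Q := by
  subst hB hG
  have hB' := isElliptic_of_discOf_ne_zero 0 1 0 921496 (-42723276) (by decide +kernel)
  have hG' := isElliptic_of_discOf_ne_zero 0 1 0 (-117) (-541) (by decide +kernel)
  refine @threeCongruent_of_dualHesseCertificate_unconditional _ _ hB' hG' (-58564) 5 (1 / 88 : ℚ) (by norm_num) ?_ ?_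
  · rw [eval_hesseD3]
    norm_num [WeierstrassCurve.c₆, WeierstrassCurve.c₄, WeierstrassCurve.b₂, WeierstrassCurve.b₄,
      WeierstrassCurve.b₆]
  · rw [eval_hesseC6three]
    norm_num [WeierstrassCurve.c₆, WeierstrassCurve.c₄, WeierstrassCurve.b₂, WeierstrassCurve.b₄,
      WeierstrassCurve.b₆]

/-- **`G[3] ≃ B[3]`** for `G = [0, 1, 0, 18291, -1461221]`, `B = [0, 1, 0, -29057010, 110185156908]`: closed partner A0 = 11552p1 of cell 173280f1, member (61636:1) of the direct Hesse pencil of 173280f1 (cc-eng-2 X3E v1.3 exact certificate, u^2 = 182756250000/1); Hesse certificate `(λ, μ, u) = (61636, 1, 427500)`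
(kernel-checked identities `𝔠(λ,μ) = u⁴c₄(G)`, `u⁶c₆(G)`). Per pair; books nothing. [cite: Fisher2012Hessian, Thm. 13.2 (n = 3)] -/
theorem threeCongruent_173280f1_11552p1_x3e (B G : WeierstrassCurve ℚ)
    (hB : B = ⟨0, 1, 0, (-29057010), 110185156908⟩) (hG : G = ⟨0, 1, 0, 18291, (-1461221)⟩) :
    ∃ e : geomTorsion G (3 : ℤ) ≃+ geomTorsion B (3 : ℤ),
      ∀ (σ : Field.absoluteGaloisGroup ℚ) (Q : geomTorsion G (3 : ℤ)), e (σ • Q) = σ • e Q := by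
  subst hB hG
  have hB' := isElliptic_of_discOf_ne_zero 0 1 0 (-29057010) 110185156908 (by decide +kernel)
  have hG' := isElliptic_of_discOf_ne_zero 0 1 0 18291 (-1461221) (by decide +kernel)
  refine @threeCongruent_of_hesseCertificate_unconditional _ _ hB' hG' (61636) 1 427500 (by norm_num) ?_ ?_
  · rw [eval_hesseC4three]
    norm_num [WeierstrassCurve.c₆, WeierstrassCurve.c₄, WeierstrassCurve.b₂, WeierstrassCurve.b₄,
      WeierstrassCurve.b₆]
  · rw [eval_hesseC6three]
    norm_num [WeierstrassCurve.c₆, WeierstrassCurve.c₄, WeierstrassCurve.b₂, WeierstrassCurve.b₄,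
      WeierstrassCurve.b₆]

/-- **`G[3] ≃ B[3]`** for `G = [0, 1, 0, -117, -541]`, `B = [0, 1, 0, -592629968, 64819340434836]`: closed partner A0 = 1936f1 of cell 180048j1, member (2200748:29) of the direct Hesse pencil of 180048j1 (cc-eng-2 X3E v1.3 exact certificate, u^2 = 1223711431531167744/1); Hesse certificate `(λ, μ, u) = (2200748, 29, 1106214912)`
(kernel-checked identities `𝔠(λ,μ) = u⁴c₄(G)`, `u⁶c₆(G)`). Per pair; books nothing. [cite: Fisher2012Hessian, Thm. 13.2 (n = 3)] -/
theorem threeCongruent_180048j1_1936f1_x3e (B G : WeierstrassCurve ℚ)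
    (hB : B = ⟨0, 1, 0, (-592629968), 64819340434836⟩) (hG : G = ⟨0, 1, 0, (-117), (-541)⟩) :
    ∃ e : geomTorsion G (3 : ℤ) ≃+ geomTorsion B (3 : ℤ),
      ∀ (σ : Field.absoluteGaloisGroup ℚ) (Q : geomTorsion G (3 : ℤ)), e (σ • Q) = σ • e Q := by
  subst hB hG
  have hB' := isElliptic_of_discOf_ne_zero 0 1 0 (-592629968) 64819340434836 (by decide +kernel)
  have hG' := isElliptic_of_discOf_ne_zero 0 1 0 (-117) (-541) (by decide +kernel)
  refine @threeCongruent_of_hesseCertificate_unconditional _ _ hB' hG' (2200748) 29 1106214912 (by norm_num) ?_ ?_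
  · rw [eval_hesseC4three]
    norm_num [WeierstrassCurve.c₆, WeierstrassCurve.c₄, WeierstrassCurve.b₂, WeierstrassCurve.b₄,
      WeierstrassCurve.b₆]
  · rw [eval_hesseC6three]
    norm_num [WeierstrassCurve.c₆, WeierstrassCurve.c₄, WeierstrassCurve.b₂, WeierstrassCurve.b₄,
      WeierstrassCurve.b₆]

/-- **`G[3] ≃ B[3]`** for `G = [0, 1, 0, -117, -541]`, `B = [0, 1, 0, -4897768, -48701510860]`: closed partner A0 = 1936f1 of cell 180048m1, member (-432532:17) of the dual Hesse pencil of 180048m1 (cc-eng-2 X3E v1.3 exact certificate, u^2 = 1/7744); Hesse certificate `(λ, μ, u) = (-432532, 17, 1/88)`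
(kernel-checked identities `𝔠(λ,μ) = u⁴c₄(G)`, `u⁶c₆(G)`). Per pair; books nothing. [cite: Fisher2012Hessian, §13 (analogue of Thm. 13.2 for X_E^-(3))] -/
theorem threeCongruent_180048m1_1936f1_x3e (B G : WeierstrassCurve ℚ)
    (hB : B = ⟨0, 1, 0, (-4897768), (-48701510860)⟩) (hG : G = ⟨0, 1, 0, (-117), (-541)⟩) :
    ∃ e : geomTorsion G (3 : ℤ) ≃+ geomTorsion B (3 : ℤ),
      ∀ (σ : Field.absoluteGaloisGroup ℚ) (Q : geomTorsion G (3 : ℤ)), e (σ • Q) = σ • e Q := by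
  subst hB hG
  have hB' := isElliptic_of_discOf_ne_zero 0 1 0 (-4897768) (-48701510860) (by decide +kernel)
  have hG' := isElliptic_of_discOf_ne_zero 0 1 0 (-117) (-541) (by decide +kernel)
  refine @threeCongruent_of_dualHesseCertificate_unconditional _ _ hB' hG' (-432532) 17 (1 / 88 : ℚ) (by norm_num) ?_ ?_
  · rw [eval_hesseD3]
    norm_num [WeierstrassCurve.c₆, WeierstrassCurve.c₄, WeierstrassCurve.b₂, WeierstrassCurve.b₄,
      WeierstrassCurve.b₆]
  · rw [eval_hesseC6three]
    norm_num [WeierstrassCurve.c₆, WeierstrassCurve.c₄, WeierstrassCurve.b₂, WeierstrassCurve.b₄,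
      WeierstrassCurve.b₆]

/-- **`G[3] ≃ B[3]`** for `G = [0, 1, 0, -117, -541]`, `B = [0, 1, 0, -17861928, -29062342476]`: closed partner A0 = 1936f1 of cell 272976bo1, member (-34772:1) of the direct Hesse pencil of 272976bo1 (cc-eng-2 X3E v1.3 exact certificate, u^2 = 11726290944/1); Hesse certificate `(λ, μ, u) = (-34772, 1, 108288)`
(kernel-checked identities `𝔠(λ,μ) = u⁴c₄(G)`, `u⁶c₆(G)`). Per pair; books nothing. [cite: Fisher2012Hessian, Thm. 13.2 (n = 3)] -/
theorem threeCongruent_272976bo1_1936f1_x3e (B G : WeierstrassCurve ℚ)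
    (hB : B = ⟨0, 1, 0, (-17861928), (-29062342476)⟩) (hG : G = ⟨0, 1, 0, (-117), (-541)⟩) :
    ∃ e : geomTorsion G (3 : ℤ) ≃+ geomTorsion B (3 : ℤ),
      ∀ (σ : Field.absoluteGaloisGroup ℚ) (Q : geomTorsion G (3 : ℤ)), e (σ • Q) = σ • e Q := by
  subst hB hG
  have hB' := isElliptic_of_discOf_ne_zero 0 1 0 (-17861928) (-29062342476) (by decide +kernel)
  have hG' := isElliptic_of_discOf_ne_zero 0 1 0 (-117) (-541) (by decide +kernel)
  refine @threeCongruent_of_hesseCertificate_unconditional _ _ hB' hG' (-34772) 1 108288 (by norm_num) ?_ ?_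
  · rw [eval_hesseC4three]
    norm_num [WeierstrassCurve.c₆, WeierstrassCurve.c₄, WeierstrassCurve.b₂, WeierstrassCurve.b₄,
      WeierstrassCurve.b₆]
  · rw [eval_hesseC6three]
    norm_num [WeierstrassCurve.c₆, WeierstrassCurve.c₄, WeierstrassCurve.b₂, WeierstrassCurve.b₄,
      WeierstrassCurve.b₆]

/-- **`G[3] ≃ B[3]`** for `G = [0, 1, 0, -117, -541]`, `B = [0, 1, 0, -2161293328, 38673332662292]`: closed partner A0 = 1936f1 of cell 272976bq1, member (4376812:13) of the dual Hesse pencil of 272976bq1 (cc-eng-2 X3E v1.3 exact certificate, u^2 = 1/30976); Hesse certificate `(λ, μ, u) = (4376812, 13, 1/176)`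
(kernel-checked identities `𝔠(λ,μ) = u⁴c₄(G)`, `u⁶c₆(G)`). Per pair; books nothing. [cite: Fisher2012Hessian, §13 (analogue of Thm. 13.2 for X_E^-(3))] -/
theorem threeCongruent_272976bq1_1936f1_x3e (B G : WeierstrassCurve ℚ)
    (hB : B = ⟨0, 1, 0, (-2161293328), 38673332662292⟩) (hG : G = ⟨0, 1, 0, (-117), (-541)⟩) :
    ∃ e : geomTorsion G (3 : ℤ) ≃+ geomTorsion B (3 : ℤ),
      ∀ (σ : Field.absoluteGaloisGroup ℚ) (Q : geomTorsion G (3 : ℤ)), e (σ • Q) = σ • e Q := by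
  subst hB hG
  have hB' := isElliptic_of_discOf_ne_zero 0 1 0 (-2161293328) 38673332662292 (by decide +kernel)
  have hG' := isElliptic_of_discOf_ne_zero 0 1 0 (-117) (-541) (by decide +kernel)
  refine @threeCongruent_of_dualHesseCertificate_unconditional _ _ hB' hG' (4376812) 13 (1 / 176 : ℚ) (by norm_num) ?_ ?_
  · rw [eval_hesseD3]
    norm_num [WeierstrassCurve.c₆, WeierstrassCurve.c₄, WeierstrassCurve.b₂, WeierstrassCurve.b₄,
      WeierstrassCurve.b₆]
  · rw [eval_hesseC6three]
    norm_num [WeierstrassCurve.c₆, WeierstrassCurve.c₄, WeierstrassCurve.b₂, WeierstrassCurve.b₄,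
      WeierstrassCurve.b₆]

/-- **`G[3] ≃ B[3]`** for `G = [0, 1, 0, -114, -2528]`, `B = [0, 1, 0, -3924720, -3766448484]`: closed partner A0 = 1568f1 of cell 277536bh1, member (-7124:1) of the dual Hesse pencil of 277536bh1 (cc-eng-2 X3E v1.3 exact certificate, u^2 = 1/1882384); Hesse certificate `(λ, μ, u) = (-7124, 1, 1/1372)`
(kernel-checked identities `𝔠(λ,μ) = u⁴c₄(G)`, `u⁶c₆(G)`). Per pair; books nothing. [cite: Fisher2012Hessian, §13 (analogue of Thm. 13.2 for X_E^-(3))] -/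
theorem threeCongruent_277536bh1_1568f1_x3e (B G : WeierstrassCurve ℚ)
    (hB : B = ⟨0, 1, 0, (-3924720), (-3766448484)⟩) (hG : G = ⟨0, 1, 0, (-114), (-2528)⟩) :
    ∃ e : geomTorsion G (3 : ℤ) ≃+ geomTorsion B (3 : ℤ),
      ∀ (σ : Field.absoluteGaloisGroup ℚ) (Q : geomTorsion G (3 : ℤ)), e (σ • Q) = σ • e Q := by
  subst hB hG
  have hB' := isElliptic_of_discOf_ne_zero 0 1 0 (-3924720) (-3766448484) (by decide +kernel)
  have hG' := isElliptic_of_discOf_ne_zero 0 1 0 (-114) (-2528) (by decide +kernel)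
  refine @threeCongruent_of_dualHesseCertificate_unconditional _ _ hB' hG' (-7124) 1 (1 / 1372 : ℚ) (by norm_num) ?_ ?_
  · rw [eval_hesseD3]
    norm_num [WeierstrassCurve.c₆, WeierstrassCurve.c₄, WeierstrassCurve.b₂, WeierstrassCurve.b₄,
      WeierstrassCurve.b₆]
  · rw [eval_hesseC6three]
    norm_num [WeierstrassCurve.c₆, WeierstrassCurve.c₄, WeierstrassCurve.b₂, WeierstrassCurve.b₄,
      WeierstrassCurve.b₆]

/-- **`G[3] ≃ B[3]`** for `G = [1, 0, 1, -289501, -22961352]`, `B = [1, 0, 1, -15833276, -24533462302]`: closed partner A0 = 8450i1 of cell 278850ec1, member (-32435:1) of the dual Hesse pencil of 278850ec1 (cc-eng-2 X3E v1.3 exact certificate, u^2 = 1/86397025); Hesse certificate `(λ, μ, u) = (-32435, 1, 1/9295)`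
(kernel-checked identities `𝔠(λ,μ) = u⁴c₄(G)`, `u⁶c₆(G)`). Per pair; books nothing. [cite: Fisher2012Hessian, §13 (analogue of Thm. 13.2 for X_E^-(3))] -/
theorem threeCongruent_278850ec1_8450i1_x3e (B G : WeierstrassCurve ℚ)
    (hB : B = ⟨1, 0, 1, (-15833276), (-24533462302)⟩) (hG : G = ⟨1, 0, 1, (-289501), (-22961352)⟩) :
    ∃ e : geomTorsion G (3 : ℤ) ≃+ geomTorsion B (3 : ℤ),
      ∀ (σ : Field.absoluteGaloisGroup ℚ) (Q : geomTorsion G (3 : ℤ)), e (σ • Q) = σ • e Q := by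
  subst hB hG
  have hB' := isElliptic_of_discOf_ne_zero 1 0 1 (-15833276) (-24533462302) (by decide +kernel)
  have hG' := isElliptic_of_discOf_ne_zero 1 0 1 (-289501) (-22961352) (by decide +kernel)
  refine @threeCongruent_of_dualHesseCertificate_unconditional _ _ hB' hG' (-32435) 1 (1 / 9295 : ℚ) (by norm_num) ?_ ?_
  · rw [eval_hesseD3]
    norm_num [WeierstrassCurve.c₆, WeierstrassCurve.c₄, WeierstrassCurve.b₂, WeierstrassCurve.b₄,
      WeierstrassCurve.b₆]
  · rw [eval_hesseC6three]
    norm_num [WeierstrassCurve.c₆, WeierstrassCurve.c₄, WeierstrassCurve.b₂, WeierstrassCurve.b₄,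
      WeierstrassCurve.b₆]

/-- **`G[3] ≃ B[3]`** for `G = [0, 1, 0, -457, 19767]`, `B = [0, 1, 0, 5595588, -8856905310]`: closed partner A0 = 3136l1 of cell 291648in1, member (35077:1) of the dual Hesse pencil of 291648in1 (cc-eng-2 X3E v1.3 exact certificate, u^2 = 1/2458624); Hesse certificate `(λ, μ, u) = (35077, 1, 1/1568)`
(kernel-checked identities `𝔠(λ,μ) = u⁴c₄(G)`, `u⁶c₆(G)`). Per pair; books nothing. [cite: Fisher2012Hessian, §13 (analogue of Thm. 13.2 for X_E^-(3))] -/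
theorem threeCongruent_291648in1_3136l1_x3e (B G : WeierstrassCurve ℚ)
    (hB : B = ⟨0, 1, 0, 5595588, (-8856905310)⟩) (hG : G = ⟨0, 1, 0, (-457), 19767⟩) :
    ∃ e : geomTorsion G (3 : ℤ) ≃+ geomTorsion B (3 : ℤ),
      ∀ (σ : Field.absoluteGaloisGroup ℚ) (Q : geomTorsion G (3 : ℤ)), e (σ • Q) = σ • e Q := by
  subst hB hG
  have hB' := isElliptic_of_discOf_ne_zero 0 1 0 5595588 (-8856905310) (by decide +kernel)
  have hG' := isElliptic_of_discOf_ne_zero 0 1 0 (-457) 19767 (by decide +kernel)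
  refine @threeCongruent_of_dualHesseCertificate_unconditional _ _ hB' hG' (35077) 1 (1 / 1568 : ℚ) (by norm_num) ?_ ?_
  · rw [eval_hesseD3]
    norm_num [WeierstrassCurve.c₆, WeierstrassCurve.c₄, WeierstrassCurve.b₂, WeierstrassCurve.b₄,
      WeierstrassCurve.b₆]
  · rw [eval_hesseC6three]
    norm_num [WeierstrassCurve.c₆, WeierstrassCurve.c₄, WeierstrassCurve.b₂, WeierstrassCurve.b₄,
      WeierstrassCurve.b₆]

/-- **`G[3] ≃ B[3]`** for `G = [0, 1, 0, -83, -287]`, `B = [0, 1, 0, -190171283, -1003604250687]`: closed partner A0 = 6400r1 of cell 326400eu1, member (-315290:1) of the direct Hesse pencil of 326400eu1 (cc-eng-2 X3E v1.3 exact certificate, u^2 = 74067539062500/1); Hesse certificate `(λ, μ, u) = (-315290, 1, 8606250)`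
(kernel-checked identities `𝔠(λ,μ) = u⁴c₄(G)`, `u⁶c₆(G)`). Per pair; books nothing. [cite: Fisher2012Hessian, Thm. 13.2 (n = 3)] -/
theorem threeCongruent_326400eu1_6400r1_x3e (B G : WeierstrassCurve ℚ)
    (hB : B = ⟨0, 1, 0, (-190171283), (-1003604250687)⟩) (hG : G = ⟨0, 1, 0, (-83), (-287)⟩) :
    ∃ e : geomTorsion G (3 : ℤ) ≃+ geomTorsion B (3 : ℤ),
      ∀ (σ : Field.absoluteGaloisGroup ℚ) (Q : geomTorsion G (3 : ℤ)), e (σ • Q) = σ • e Q := by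
  subst hB hG
  have hB' := isElliptic_of_discOf_ne_zero 0 1 0 (-190171283) (-1003604250687) (by decide +kernel)
  have hG' := isElliptic_of_discOf_ne_zero 0 1 0 (-83) (-287) (by decide +kernel)
  refine @threeCongruent_of_hesseCertificate_unconditional _ _ hB' hG' (-315290) 1 8606250 (by norm_num) ?_ ?_
  · rw [eval_hesseC4three]
    norm_num [WeierstrassCurve.c₆, WeierstrassCurve.c₄, WeierstrassCurve.b₂, WeierstrassCurve.b₄,
      WeierstrassCurve.b₆]
  · rw [eval_hesseC6three]
    norm_num [WeierstrassCurve.c₆, WeierstrassCurve.c₄, WeierstrassCurve.b₂, WeierstrassCurve.b₄,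
      WeierstrassCurve.b₆]

/-- **`G[3] ≃ B[3]`** for `G = [0, 1, 0, 191, -3041]`, `B = [0, 1, 0, -6224833, 20862721439]`: closed partner A0 = 10816s1 of cell 356928gk1, member (-41912:1) of the dual Hesse pencil of 356928gk1 (cc-eng-2 X3E v1.3 exact certificate, u^2 = 1/1308736); Hesse certificate `(λ, μ, u) = (-41912, 1, 1/1144)`
(kernel-checked identities `𝔠(λ,μ) = u⁴c₄(G)`, `u⁶c₆(G)`). Per pair; books nothing. [cite: Fisher2012Hessian, §13 (analogue of Thm. 13.2 for X_E^-(3))] -/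
theorem threeCongruent_356928gk1_10816s1_x3e (B G : WeierstrassCurve ℚ)
    (hB : B = ⟨0, 1, 0, (-6224833), 20862721439⟩) (hG : G = ⟨0, 1, 0, 191, (-3041)⟩) :
    ∃ e : geomTorsion G (3 : ℤ) ≃+ geomTorsion B (3 : ℤ),
      ∀ (σ : Field.absoluteGaloisGroup ℚ) (Q : geomTorsion G (3 : ℤ)), e (σ • Q) = σ • e Q := by
  subst hB hG
  have hB' := isElliptic_of_discOf_ne_zero 0 1 0 (-6224833) 20862721439 (by decide +kernel)
  have hG' := isElliptic_of_discOf_ne_zero 0 1 0 191 (-3041) (by decide +kernel)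
  refine @threeCongruent_of_dualHesseCertificate_unconditional _ _ hB' hG' (-41912) 1 (1 / 1144 : ℚ) (by norm_num) ?_ ?_
  · rw [eval_hesseD3]
    norm_num [WeierstrassCurve.c₆, WeierstrassCurve.c₄, WeierstrassCurve.b₂, WeierstrassCurve.b₄,
      WeierstrassCurve.b₆]
  · rw [eval_hesseC6three]
    norm_num [WeierstrassCurve.c₆, WeierstrassCurve.c₄, WeierstrassCurve.b₂, WeierstrassCurve.b₄,
      WeierstrassCurve.b₆]

/-- **`G[3] ≃ B[3]`** for `G = [0, -1, 0, -3, -1]`, `B = [0, -1, 0, -11834763, -15748500825]`: closed partner A0 = 256d1 of cell 423168k1, member (-1709080:67) of the dual Hesse pencil of 423168k1 (cc-eng-2 X3E v1.3 exact certificate, u^2 = 1/64); Hesse certificate `(λ, μ, u) = (-1709080, 67, 1/8)`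
(kernel-checked identities `𝔠(λ,μ) = u⁴c₄(G)`, `u⁶c₆(G)`). Per pair; books nothing. [cite: Fisher2012Hessian, §13 (analogue of Thm. 13.2 for X_E^-(3))] -/
theorem threeCongruent_423168k1_256d1_x3e (B G : WeierstrassCurve ℚ)
    (hB : B = ⟨0, (-1), 0, (-11834763), (-15748500825)⟩) (hG : G = ⟨0, (-1), 0, (-3), (-1)⟩) :
    ∃ e : geomTorsion G (3 : ℤ) ≃+ geomTorsion B (3 : ℤ),
      ∀ (σ : Field.absoluteGaloisGroup ℚ) (Q : geomTorsion G (3 : ℤ)), e (σ • Q) = σ • e Q := by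
  subst hB hG
  have hB' := isElliptic_of_discOf_ne_zero 0 (-1) 0 (-11834763) (-15748500825) (by decide +kernel)
  have hG' := isElliptic_of_discOf_ne_zero 0 (-1) 0 (-3) (-1) (by decide +kernel)
  refine @threeCongruent_of_dualHesseCertificate_unconditional _ _ hB' hG' (-1709080) 67 (1 / 8 : ℚ) (by norm_num) ?_ ?_
  · rw [eval_hesseD3]
    norm_num [WeierstrassCurve.c₆, WeierstrassCurve.c₄, WeierstrassCurve.b₂, WeierstrassCurve.b₄,
      WeierstrassCurve.b₆]
  · rw [eval_hesseC6three]
    norm_num [WeierstrassCurve.c₆, WeierstrassCurve.c₄, WeierstrassCurve.b₂, WeierstrassCurve.b₄,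
      WeierstrassCurve.b₆]

end Summit.BirchSwinnertonDyer.Rank1Residual.X11a.SelmerCompanion.Congruences

end
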